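import Summits.CriticalPhenomena.PercolationContinuityZ3.Theorems.PercNearOneGluingNoHeavyLowerTailCILSetStarTools
import Summits.CriticalPhenomena.PercolationContinuityZ3.Theorems.PercNearOneGluingNoHeavyLowerTailCILExchangeTools
import HarnessLib

/-!
# `NoHeavyLowerTail` (stmt-CriticalPhenomena-4575) — the TOP GATE CLASS of the flat expansion is free for a champion

Support file (prover `prim-hp-6`, hull-port cell, observer-set / OES technique, gen 3; `--supports stmt-CriticalPhenomena-4575`).
No definitions, no named facts, no sorries.

Setting of `…CILSetStarTools` (prover `prim-gen-induct`): `μ = prodBernoulli w` on `Fin n`, relays `A`, level `j`, an observer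
set `S`, the configuration OFF `S` `ξ(ω) = ω ∩ {e | ∀ v ∈ S, v ∉ e}` and `~'` = reachability in `ξ(ω)`.  The flat expansion
`SetStar.setL_eq_sum / setR_eq_sum` writes set-champion stability `CS_w(S, c)` as a sum over gate classes `{Γ = Y}` of the
`ξ`-quantities `μ(c ≁' Y, 1 ≤ |π'(Y)| ≤ j)` versus `μ(c ≁' Y, |π'(c)| ≤ j)` (`CS_K(Y, c)` "read off `ξ`").  For two gates every
class is handled by the reference witness `champ(K)` (`…CILTwoGate`); for three or more gates that single reference fails
(crux notes BLOBQUOTIENT.md §20 addendum) and per-class inputs are needed.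

This file supplies the input for the TOP class `Y = N` — the whole neighbourhood `N = {u ∉ S | ∃ v ∈ S, w s(u,v) ≠ 0}` of
`S` — with NO reference witness and NO induction hypothesis: if `c ∉ S ∪ N` dominates (in `w` itself) one vertex `y₀ ∈ N`
(e.g. `c` is a champion of `w` and `N` contains a relay), then
  `μ(c ≁' N, |π'(N)| ≤ j) ≤ μ(c ≁' N, |π'(c)| ≤ j)`      (`SetPort.topClass_le_of_dominated`),
hence in particular `CS_K(N, c)` read off `ξ` (`SetPort.setCS_topClass`, with the `1 ≤ |π'(N)|` form of the left event).

PROOF.  Apply AWAY-domination (`ExchangeTools.away`, van den Berg–Häggström–Kahn Thm. 1.5) IN `w` with the avoided set `W = N`: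
`μ(c ↮ N, M_{y₀} ≤ j) ≤ μ(c ↮ N, M_c ≤ j)`.  Then transfer both sides to `ξ`-events: on the support (every open edge has
positive weight) every gate lies in `N`, so (i) `c ≁' N` forces `c ↮ S` (a path into `S` enters through a gate, `exists_gate_of_reachable`),
hence `c ↮ N` in `ω` and the cluster of `c` is its `ξ`-cluster (`reachable_off_of_forall_not`); (ii) every relay joined to `y₀`
in `ω` is `~'`-joined to some vertex of `N` (through `S` via a gate, or directly), so `M_{y₀}(ω) ≤ |π'(N)|`; (iii) conversely
`c ↮ N` in `ω` trivially gives `c ≁' N` and `|π'(c)| ≤ M_c(ω)`.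
This is the "`H`-row" `AWAY_H(c ≥ y₀; W = N)` of the type-level certificates in HP6-MEMO4-FLATLP.md §4 (crux evidence): the
all-gates term of the flat expansion needs no witness shift for a champion.
-/

noncomputable section

namespace Summit.CriticalPhenomena.PercolationContinuityZ3.Theorems

open MeasureTheory Set Literature.Probability.LatticeModels Literature.Probability.Percolation
open scoped Classical BigOperators

variable {n : ℕ}

namespace SetPort

open CutObserver CutObserver.SetStar

/-- **The top gate class is free for a dominating vertex.**  Let `S` be disjoint from the relays `A`,
`N = {u ∉ S | ∃ v ∈ S, w s(u,v) ≠ 0}` its neighbourhood, `c ∉ S` with no positive pair to `S`, and `y₀ ∈ N` with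
`μ(M_{y₀} ≤ j) ≤ μ(M_c ≤ j)` (domination in `w` itself).  Then, with `~'` the reachability off `S`,
`μ(c ≁' N, |{z ∈ A : ∃ u ∈ N, u ~' z}| ≤ j) ≤ μ(c ≁' N, |{z ∈ A : c ~' z}| ≤ j)`.
[derived from: VandenbergHaggstromKahn2005, Thm. 1.5, via `ExchangeTools.away`] -/
theorem topClass_le_of_dominated (w : Sym2 (Fin n) → unitInterval) (A S : Finset (Fin n)) (c y₀ : Fin n) (j : ℕ)
    (hSA : Disjoint S A) (hcS : c ∉ S) (hcN : ∀ v ∈ S, w s(c, v) = 0)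
    (hy₀S : y₀ ∉ S) (hy₀ : ∃ v ∈ S, w s(y₀, v) ≠ 0)
    (hdom : (prodBernoulli w).real {ω : BondConfig (Fin n) | (A.filter fun x => ω ∈ openConn y₀ x).card ≤ j} ≤
      (prodBernoulli w).real {ω : BondConfig (Fin n) | (A.filter fun x => ω ∈ openConn c x).card ≤ j}) :
    (prodBernoulli w).real
        ({ω : BondConfig (Fin n) | ∀ u ∈ (Finset.univ.filter fun u => u ∉ S ∧ ∃ v ∈ S, w s(u, v) ≠ 0),
            ¬ (openGraph (ω ∩ {e | ∀ v ∈ S, v ∉ e})).Reachable c u} ∩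
          {ω | (A.filter fun z => ∃ u ∈ (Finset.univ.filter fun u => u ∉ S ∧ ∃ v ∈ S, w s(u, v) ≠ 0),
            (openGraph (ω ∩ {e | ∀ v ∈ S, v ∉ e})).Reachable u z).card ≤ j}) ≤
      (prodBernoulli w).real
        ({ω : BondConfig (Fin n) | ∀ u ∈ (Finset.univ.filter fun u => u ∉ S ∧ ∃ v ∈ S, w s(u, v) ≠ 0),
            ¬ (openGraph (ω ∩ {e | ∀ v ∈ S, v ∉ e})).Reachable c u} ∩
          {ω | (A.filter fun z => (openGraph (ω ∩ {e | ∀ v ∈ S, v ∉ e})).Reachable c z).card ≤ j}) := by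
  set μ := prodBernoulli w with hμ
  set N : Finset (Fin n) := Finset.univ.filter fun u => u ∉ S ∧ ∃ v ∈ S, w s(u, v) ≠ 0 with hN
  have hy₀N : y₀ ∈ N := Finset.mem_filter.2 ⟨Finset.mem_univ _, hy₀S, hy₀⟩
  have hcNmem : c ∉ N := by
    intro h
    obtain ⟨-, -, v, hv, hne⟩ := Finset.mem_filter.1 h
    exact hne (hcN v hv)
  -- AWAY-domination in `w` with the avoided set `N`
  have key := ExchangeTools.away w A N c y₀ j hdom
  -- notation for the events
  set SUPP : Set (BondConfig (Fin n)) := {ω | ∀ e ∈ ω, w e ≠ 0} with hSUPP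
  set LT : Set (BondConfig (Fin n)) :=
    {ω : BondConfig (Fin n) | ∀ u ∈ N, ¬ (openGraph (ω ∩ {e | ∀ v ∈ S, v ∉ e})).Reachable c u} ∩
      {ω | (A.filter fun z => ∃ u ∈ N, (openGraph (ω ∩ {e | ∀ v ∈ S, v ∉ e})).Reachable u z).card ≤ j} with hLT
  set RT : Set (BondConfig (Fin n)) :=
    {ω : BondConfig (Fin n) | ∀ u ∈ N, ¬ (openGraph (ω ∩ {e | ∀ v ∈ S, v ∉ e})).Reachable c u} ∩
      {ω | (A.filter fun z => (openGraph (ω ∩ {e | ∀ v ∈ S, v ∉ e})).Reachable c z).card ≤ j} with hRT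
  set LK : Set (BondConfig (Fin n)) := {ω : BondConfig (Fin n) | ∀ v ∈ N, ω ∉ openConn c v} ∩
      {ω | (A.filter fun x => ω ∈ openConn y₀ x).card ≤ j} with hLK
  set RK : Set (BondConfig (Fin n)) := {ω : BondConfig (Fin n) | ∀ v ∈ N, ω ∉ openConn c v} ∩
      {ω | (A.filter fun x => ω ∈ openConn c x).card ≤ j} with hRK
  -- on the support, every gate lies in `N`
  have gateN : ∀ {ω : BondConfig (Fin n)}, ω ∈ SUPP → ∀ u, u ∉ S → (∃ v ∈ S, s(u, v) ∈ ω) → u ∈ N := by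
    intro ω hω u huS hex
    obtain ⟨v, hvS, huv⟩ := hex
    exact Finset.mem_filter.2 ⟨Finset.mem_univ _, huS, v, hvS, hω _ huv⟩
  -- (1) LT ∩ SUPP ⊆ LK
  have h1 : LT ∩ SUPP ⊆ LK := by
    rintro ω ⟨⟨hcno, hcard⟩, hω⟩
    -- `c` is joined (in ω) to no vertex of `S`
    have hcS' : ∀ x ∈ S, ¬ (openGraph ω).Reachable c x := by
      intro x hxS hcx
      obtain ⟨u, huS, hedge, hcu⟩ := exists_gate_of_reachable hcS hxS hcx
      exact hcno u (gateN hω u huS hedge) hcu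
    refine ⟨?_, ?_⟩
    · -- `c ↮ N` in ω
      intro v hvN hcv
      have hcv' : (openGraph ω).Reachable c v := hcv
      exact hcno v hvN (reachable_off_of_forall_not hcS' hcv')
    · -- `M_{y₀}(ω) ≤ |π'(N)|`
      change (A.filter fun x => ω ∈ openConn y₀ x).card ≤ j
      refine le_trans (Finset.card_le_card fun z hz => ?_) hcard
      simp only [Finset.mem_filter] at hz ⊢
      refine ⟨hz.1, ?_⟩
      have hyz : (openGraph ω).Reachable y₀ z := hz.2
      have hzS : z ∉ S := fun h => Finset.disjoint_left.1 hSA h hz.1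
      by_cases hyS : ∃ x ∈ S, (openGraph ω).Reachable y₀ x
      · -- through `S`: `z` is joined to `S`, hence `~'`-joined to a gate, which lies in `N`
        obtain ⟨x, hxS, hyx⟩ := hyS
        have hzx : (openGraph ω).Reachable z x := hyz.symm.trans hyx
        obtain ⟨u, huS, hedge, hzu⟩ := exists_gate_of_reachable hzS hxS hzx
        exact ⟨u, gateN hω u huS hedge, hzu.symm⟩
      · -- off `S`: the cluster of `y₀` is its `ξ`-cluster
        have hno : ∀ x ∈ S, ¬ (openGraph ω).Reachable y₀ x := fun x hx h => hyS ⟨x, hx, h⟩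
        exact ⟨y₀, hy₀N, reachable_off_of_forall_not hno hyz⟩
  -- (2) RK ⊆ RT
  have h2 : RK ⊆ RT := by
    rintro ω ⟨hcno, hcard⟩
    refine ⟨?_, ?_⟩
    · intro u huN hcu
      exact hcno u huN (show ω ∈ openConn c u from reachable_mono inter_subset_left hcu)
    · change (A.filter fun z => (openGraph (ω ∩ {e | ∀ v ∈ S, v ∉ e})).Reachable c z).card ≤ j
      change (A.filter fun x => ω ∈ openConn c x).card ≤ j at hcard
      refine le_trans (Finset.card_le_card fun z hz => ?_) hcard
      simp only [Finset.mem_filter] at hz ⊢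
      exact ⟨hz.1, show ω ∈ openConn c z from reachable_mono inter_subset_left hz.2⟩
  -- assemble
  calc μ.real LT = μ.real (LT ∩ SUPP) := by rw [hμ, measureReal_inter_support]
    _ ≤ μ.real LK := measureReal_mono h1 (measure_ne_top _ _)
    _ ≤ μ.real RK := by rw [hμ, hLK, hRK]; exact key
    _ ≤ μ.real RT := measureReal_mono h2 (measure_ne_top _ _)

/-- **`CS_K(N, c)` at the top gate class, read off `ξ`, for a dominating vertex.**  Same hypotheses as
`topClass_le_of_dominated`; the left event carries the extra condition `1 ≤ |π'(N)|` of set-champion stability: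
`μ(c ≁' N, 1 ≤ |π'(N)| ≤ j) ≤ μ(c ≁' N, |π'(c)| ≤ j)`.  This is the input of `SetStar.setCS_of_classWitnesses` / the
flat expansion for the class `Y = N(S)`, with the champion itself as witness (no induction hypothesis, any number of gates).
[derived from: VandenbergHaggstromKahn2005, Thm. 1.5, via `topClass_le_of_dominated`] -/
theorem setCS_topClass (w : Sym2 (Fin n) → unitInterval) (A S : Finset (Fin n)) (c y₀ : Fin n) (j : ℕ)
    (hSA : Disjoint S A) (hcS : c ∉ S) (hcN : ∀ v ∈ S, w s(c, v) = 0)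
    (hy₀S : y₀ ∉ S) (hy₀ : ∃ v ∈ S, w s(y₀, v) ≠ 0)
    (hdom : (prodBernoulli w).real {ω : BondConfig (Fin n) | (A.filter fun x => ω ∈ openConn y₀ x).card ≤ j} ≤
      (prodBernoulli w).real {ω : BondConfig (Fin n) | (A.filter fun x => ω ∈ openConn c x).card ≤ j}) :
    (prodBernoulli w).real
        ({ω : BondConfig (Fin n) | ∀ u ∈ (Finset.univ.filter fun u => u ∉ S ∧ ∃ v ∈ S, w s(u, v) ≠ 0),
            ¬ (openGraph (ω ∩ {e | ∀ v ∈ S, v ∉ e})).Reachable c u} ∩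
          {ω | 1 ≤ (A.filter fun z => ∃ u ∈ (Finset.univ.filter fun u => u ∉ S ∧ ∃ v ∈ S, w s(u, v) ≠ 0),
              (openGraph (ω ∩ {e | ∀ v ∈ S, v ∉ e})).Reachable u z).card ∧
            (A.filter fun z => ∃ u ∈ (Finset.univ.filter fun u => u ∉ S ∧ ∃ v ∈ S, w s(u, v) ≠ 0),
              (openGraph (ω ∩ {e | ∀ v ∈ S, v ∉ e})).Reachable u z).card ≤ j}) ≤
      (prodBernoulli w).real
        ({ω : BondConfig (Fin n) | ∀ u ∈ (Finset.univ.filter fun u => u ∉ S ∧ ∃ v ∈ S, w s(u, v) ≠ 0),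
            ¬ (openGraph (ω ∩ {e | ∀ v ∈ S, v ∉ e})).Reachable c u} ∩
          {ω | (A.filter fun z => (openGraph (ω ∩ {e | ∀ v ∈ S, v ∉ e})).Reachable c z).card ≤ j}) := by
  refine le_trans (measureReal_mono ?_ (measure_ne_top _ _))
    (topClass_le_of_dominated w A S c y₀ j hSA hcS hcN hy₀S hy₀ hdom)
  rintro ω ⟨h1, -, h3⟩
  exact ⟨h1, h3⟩

end SetPort

end Summit.CriticalPhenomena.PercolationContinuityZ3.Theorems

end
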